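import Summits.BirchSwinnertonDyer.BirchSwinnertonDyer.Theses.GoldfeldAllTwistsTwoConverse
import Summits.BirchSwinnertonDyer.BirchSwinnertonDyer.Theorems.GoldfeldAllTwistsTwoConverseTwinAdditiveHeegnerIndex
import HarnessLib

set_option linter.dupNamespace false
set_option autoImplicit false

/-!
# Crux twin″ = `BSDTwoCMSevenAdditiveRankOne` (item stmt-BirchSwinnertonDyer-19140) —
# skeleton of the REGISTERED line «heegner-halves» (skeleton sha a20572d66ae139e2, c301 g0, 2026-08-26)

Reconstruction (leafhand-bsd-goldfeldalltwistst-2-g0, 2026-08-30) of the registered skeleton from the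
three registered stub signatures (verbatim) and the landed consumer
`GoldfeldGoodTwists.bsdTwoCMSevenAdditiveRankOne_of_heegnerIndexAtTwo`
(`Theorems/GoldfeldAllTwistsTwoConverseTwinAdditiveHeegnerIndex.lean`, p418420); the original file
lived in an unmounted seat folder and its evidence copy `Lines_heegner-halves_19140.lean` is archived.

LINE: cell bsd-cm's `L`-FREE reformulation of the CM rank-one corner at `2`
(`P2.bsdp_two_iff_cmHeegnerIndex`): granted Gross–Zagier, Kolyvagin, GZK, modularity and
Burungale–Flach for the rank-zero twin, `BSD(E,2) ⟺ ord₂ 𝔮 = ord₂ #Ш(E)` with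
`𝔮 = cmHeegnerIndexQuotient …`. The identity is split into its two halves (stubs 1–2, both NOT in
print: Li–Tian–Yan–Zhu 2025 §1.3 (II)); the eight published binders of the consumer are stub 3.
Composition `BSDTwoCMSevenAdditiveRankOne_of` is kernel-checked; sorries ONLY in `stub_*`.
-/

namespace Summit.BirchSwinnertonDyer.BirchSwinnertonDyer.Cruxes.BSDTwoCMSevenAdditiveRankOne.HeegnerHalves

noncomputable section

open scoped Classical

open WeierstrassCurve NumberField Literature.NumberTheory.EllipticCurves
  Literature.NumberTheory.EllipticCurves.ModularForms
  Literature.NumberTheory.EllipticCurves.Rank1Residual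
open Summit.BirchSwinnertonDyer.Rank1Residual.P2
open Summit.BirchSwinnertonDyer.BirchSwinnertonDyer.Theorems.GoldfeldGoodTwists

/-- stub (1) [XL; Euler-system half — NOT in print at additive `2`]: `ord₂ #Ш(E) ≤ ord₂ 𝔮` on the cell. -/
theorem stub_heegnerIndexUpperAtTwo :
    ∀ (W : WeierstrassCurve ℚ) [W.IsElliptic] [W.IsGloballyMinimal] (N : ℕ) [NeZero N] (K : Type) [Field K]
      [NumberField K] (Dt : ModularParametrizationData W N) (H : HeegnerDatum N (NumberField.discr K))
      (ι : K →+* ℂ) (P : (W.baseChange K).toAffine.Point) (Wd : WeierstrassCurve ℚ) [Wd.IsElliptic]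
      [Wd.IsGloballyMinimal] (Cd : VariableChange ℚ) (k : ℕ), W.HasCM → CMSplit W 2 →
      ¬ W.HasGoodReductionAtPrime 2 → W.analyticRank = 1 → IsImaginaryQuadratic K →
      SatisfiesHeegnerHypothesis N K →
      WeierstrassCurve.Affine.Point.map ι.toRatAlgHom P = heegnerPointComplex Dt H →
      (W.quadraticTwist (NumberField.discr K : ℚ)).entireLFunction 1 ≠ 0 →
      Cd • W.quadraticTwist (NumberField.discr K : ℚ) = Wd → (k = 1 ∨ k = 2) →
      (k = 2 ↔ ∀ y : W.toAffine.Point, ∃ Q : (W.baseChange K).toAffine.Point,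
        QuadraticDescent.incl K W y - (2 : ℤ) • Q ∈ AddCommGroup.torsion (W.baseChange K).toAffine.Point) →
      (padicValNat 2 (Nat.card W.sha) : ℤ) ≤ padicValRat 2 (cmHeegnerIndexQuotient W K P Dt.c k Wd Cd.u) := by
  sorry

/-- stub (2) [XL; main-conjecture / exact-2-divisibility half — NOT in print at additive `2`]:
`ord₂ 𝔮 ≤ ord₂ #Ш(E)` on the cell. -/
theorem stub_heegnerIndexLowerAtTwo :
    ∀ (W : WeierstrassCurve ℚ) [W.IsElliptic] [W.IsGloballyMinimal] (N : ℕ) [NeZero N] (K : Type) [Field K]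
      [NumberField K] (Dt : ModularParametrizationData W N) (H : HeegnerDatum N (NumberField.discr K))
      (ι : K →+* ℂ) (P : (W.baseChange K).toAffine.Point) (Wd : WeierstrassCurve ℚ) [Wd.IsElliptic]
      [Wd.IsGloballyMinimal] (Cd : VariableChange ℚ) (k : ℕ), W.HasCM → CMSplit W 2 →
      ¬ W.HasGoodReductionAtPrime 2 → W.analyticRank = 1 → IsImaginaryQuadratic K →
      SatisfiesHeegnerHypothesis N K →
      WeierstrassCurve.Affine.Point.map ι.toRatAlgHom P = heegnerPointComplex Dt H →
      (W.quadraticTwist (NumberField.discr K : ℚ)).entireLFunction 1 ≠ 0 →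
      Cd • W.quadraticTwist (NumberField.discr K : ℚ) = Wd → (k = 1 ∨ k = 2) →
      (k = 2 ↔ ∀ y : W.toAffine.Point, ∃ Q : (W.baseChange K).toAffine.Point,
        QuadraticDescent.incl K W y - (2 : ℤ) • Q ∈ AddCommGroup.torsion (W.baseChange K).toAffine.Point) →
      padicValRat 2 (cmHeegnerIndexQuotient W K P Dt.c k Wd Cd.u) ≤ padicValNat 2 (Nat.card W.sha) := by
  sorry

/-- stub (3) [print; the eight published binders of the consumer, BY NAME — each a cite-tagged Literature
`Prop` whose `_holds` waits on the Modularity Theorem / Gross–Zagier / Kolyvagin / Burungale–Flach]. -/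
theorem stub_publishedFactsTwinAtTwo :
    (∀ (N : ℕ) [NeZero N] (W : WeierstrassCurve ℚ) (K : Type) [Field K] [NumberField K], gross_zagier N W K) ∧
    (∀ (N : ℕ) [NeZero N] (W : WeierstrassCurve ℚ) (K : Type) [Field K] [NumberField K], kolyvagin N W K) ∧
    rank_eq_analyticRank_of_analyticRank_le_one ∧ hasEntireLFunction_rat ∧
    bsdTriple_of_hasCM_of_L_one_ne_zero ∧ waldspurger_exists_heegnerField_twist_ne_zero ∧
    (∀ W : WeierstrassCurve ℚ, W.even_analyticRank_iff) ∧
    (∀ (W : WeierstrassCurve ℚ) (K : Type) [Field K] [NumberField K], exists_isHeegnerPoint W K) := by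
  sorry

/-- **Composition (kernel-checked):** stubs (1)–(3) ⟹ the crux twin″, BY NAME — the two halves give the
`L`-free identity `CMSevenAdditiveHeegnerIndexAtTwo` (`le_antisymm`), and the landed consumer
`bsdTwoCMSevenAdditiveRankOne_of_heegnerIndexAtTwo` fed with the eight binders of stub (3) concludes. -/
theorem BSDTwoCMSevenAdditiveRankOne_of :
    Summit.BirchSwinnertonDyer.BirchSwinnertonDyer.Theses.GoldfeldAllTwistsTwoConverse.BSDTwoCMSevenAdditiveRankOne := by
  obtain ⟨hGZ, hKo, hGZK, hmod, hBF, hWa, hpar, hHP⟩ := stub_publishedFactsTwinAtTwo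
  refine bsdTwoCMSevenAdditiveRankOne_of_heegnerIndexAtTwo hGZ hKo hGZK hmod hBF hWa hpar hHP ?_
  intro W _ _ N _ K _ _ Dt H ι P Wd _ _ Cd k hcm hsplit hbad hr hK hHN hP hLt hWd hk12 hkiff
  exact le_antisymm
    (stub_heegnerIndexLowerAtTwo W N K Dt H ι P Wd Cd k hcm hsplit hbad hr hK hHN hP hLt hWd hk12 hkiff)
    (stub_heegnerIndexUpperAtTwo W N K Dt H ι P Wd Cd k hcm hsplit hbad hr hK hHN hP hLt hWd hk12 hkiff)

end

end Summit.BirchSwinnertonDyer.BirchSwinnertonDyer.Cruxes.BSDTwoCMSevenAdditiveRankOne.HeegnerHalves
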